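import Mathlib
import Summits.ValiantsHypothesis.ValiantsHypothesis.Theses.UlrichPadded
import Literature.Computability.AlgebraicComplexity.PermanentIrreducible
import Literature.Computability.AlgebraicComplexity.VonZurGathenSingPermHeight
import Literature.LinearAlgebra.Matrix.PermanentSubperm

/-!
# Line `subpermanent-height-three-nagata` — skeleton for crux `PermHypersurfaceFactorial`

Crux `stmt-ValiantsHypothesis-5666` = `Summit.ValiantsHypothesis.ValiantsHypothesis.Theses.UlrichPadded.PermHypersurfaceFactorial`:
for `n ≥ 3` every height-one prime of `S_n = ℂ[x_ij]/(per_n)` is principal (`S_n` is factorial).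

Line (idea card `Ideas/subpermanent-height-three-nagata.md`, triage r1-1/2/3: pass): **Nagata at the
corner minor** `P₀ = ∂per_n/∂x₀₀ = per(x(0|0))`.  Write `P_j = ∂per_n/∂x_{0j}` (the `n` maximal
subpermanents of the rows `≥ 1`; `VonZurGathen.pderiv_perPoly`) and `I = (per_n, P₀) ⊂ R = ℂ[x]`.

* `stub_rowPartialsHeightThree` — **H(n)** (load-bearing, hardest): every prime of `ℂ[x]` containing
  `P₀, …, P_{n-1}` has height `≥ 3` (`n ≥ 3`; false at `n = 2`, for `det`, and in characteristic 2).
* `stub_unmixedHeightTwo` — Macaulay unmixedness, `k = 2`: in a polynomial ring over a field a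
  two-generated ideal of height `≥ 2` has all its zero-divisors inside primes of height `≤ 2` over it
  (Cohen–Macaulay input; characteristic-free, `per`-free).
* `stub_rowPartialRegular` — H(n) + unmixedness ⇒ `P₁` is a non-zero-divisor modulo `I`
  (generic-point chain: a height-2 prime over `I ∋ P₁` would contain every `P_j`).
* `stub_cofactorChartIsDomain` — the chart `(R/I)[1/P̄₁]` is a domain (solve the row-0 Laplace
  expansion for `x₀₁`: it is `(ℂ[x ∖ x₀₁]/(P₀))[1/P₁]`, and `P₀` is an irreducible permanent).
* `stub_awayMinorUFD` — the chart `S_n[1/P̄₀]` is a UFD (solve for `x₀₀`: a localised polynomial ring).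

Composition (sorry-free, this file): regular element + domain chart ⇒ `R/I` is a domain ⇒ `I` prime ⇒
`P̄₀` is a prime ELEMENT of the noetherian domain `S_n` (`minor_notMem_span_perPoly`: `P₀ ∉ (per_n)`) ⇒
Nagata (`UniqueFactorizationMonoid.iff_localizationAway_of_prime`) with the UFD chart ⇒ `S_n` is a UFD ⇒
height-one primes are principal (`UniqueFactorizationMonoid.isPrincipal_of_height_eq_one`).
`PermHypersurfaceFactorial_of_stubs` is the composition with the five stub statements as hypotheses
(axioms `{propext, Classical.choice, Quot.sound}`); `PermHypersurfaceFactorial_of` feeds it the stubs and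
concludes the crux decl BY NAME.

Disproof.lean honoured: `permHypersurfaceFactorial_false_without_three_le` — `3 ≤ n` is used at
`stub_rowPartialsHeightThree` (H(2) is false: `rowPartialsHeightThree_false_at_two`) and at
`stub_rowPartialRegular` (at `n = 2`, `x₁₀ · x₀₁ ∈ (per₂, x₁₁)`: `cofactor_not_prime_two`);
`permHypersurfaceFactorial_false_without_heightOne` — `P.height = 1` is used in the last line of the
composition; `span_det_cofactor_not_isPrime_three` / `span_per_cofactor_not_isPrime_three_charTwo` — the
line is `per`-specific and characteristic-zero exactly at `stub_rowPartialsHeightThree` (`2 ≠ 0` in the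
principal `3 × 3` minor `2pqr` of the permanental Laplace matrix).  No `Theorems/PermHypersurfaceFactorial/Negative/`
lemma exists (2026-08-15); `ledger negatives` (5668, 0340, 3735, 3738) are unrelated.
-/

noncomputable section

set_option linter.dupNamespace false

namespace Summit.ValiantsHypothesis.ValiantsHypothesis.Cruxes.PermHypersurfaceFactorial.SubpermanentHeightThreeNagata

open MvPolynomial Literature.Computability.AlgebraicComplexity
open Literature.Computability.AlgebraicComplexity.VonZurGathen

/-! ## The registered stubs -/

/-- **Stub 1 — H(n), the load-bearing height count (hardest).**  For `n ≥ 3`, every prime ideal of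
`ℂ[x_ij]` (`n × n`) containing the `n` row-`0` partials `∂per_n/∂x_{0j} = per(x(0|j))` — the maximal
subpermanents of the generic `(n-1) × n` matrix of rows `≥ 1` — has height `≥ 3`.
(False at `n = 2`: `Disproof.rowPartialsHeightThree_false_at_two`; false for `det` (height 2) and in
characteristic 2.  Certified for `n ≤ 7` by exact Gröbner cone sections, kit j004945; in print for
`n ≤ 6`, BCMV arXiv:2402.17839 Thm 3.18.)  Proof plans: the card's three-case generic-point argument
in the idiom of `VonZurGathenSingPermHeight.lean` (`card_le_height_ker_aeval`,
`height_ker_aeval_piecewise_insert`, `aeval_blockWitness_of_mem`), or the three-stratum count of card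
`cofactor-linear-type` (rank `padj ≥ 2` on `V(per)` by the `-2` witness, rank-1 stratum proper, rank-0
stratum = `vonzurGathen1987_singPerm_height_holds`). -/
theorem stub_rowPartialsHeightThree :
    ∀ n : ℕ, (h : 3 ≤ n) → ∀ P : Ideal (MvPolynomial (Fin n × Fin n) ℂ), P.IsPrime →
      (∀ j : Fin n, pderiv ((⟨0, by omega⟩ : Fin n), j) (perPoly (Fin n) ℂ) ∈ P) →
      (3 : ℕ∞) ≤ P.height := by
  sorry

/-- **Stub 2 — unmixedness of height-two complete intersections (Macaulay; Cohen–Macaulay input).**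
In a polynomial ring in finitely many variables over a field, if `(f, g)` has height `≥ 2` then every
zero-divisor modulo `(f, g)` lies in a prime of height `≤ 2` containing `(f, g)` (all associated primes
of `K[x]/(f, g)` are minimal, of height exactly 2).  Characteristic-free and `per`-free.  Route:
`K[x]_𝔭` is regular hence Cohen–Macaulay (tree `Resolution/RegularLocalRings*`,
`RingTheory/CohenMacaulayUnmixed.lean: minimalPrimes_of_mem_associatedPrimes`), `f, g` is a regular
sequence in `K[x]_𝔭` when `ht (f,g) ≥ 2`, and associated primes localise
(Mathlib `associatedPrimes`, `biUnion_associatedPrimes_eq_zero_divisors`). -/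
theorem stub_unmixedHeightTwo :
    ∀ (K : Type) [Field K] (σ : Type) [Fintype σ] (f g s : MvPolynomial σ K),
      (2 : ℕ∞) ≤ (Ideal.span {f, g}).height →
      (∃ a : MvPolynomial σ K, a ∉ Ideal.span {f, g} ∧ s * a ∈ Ideal.span {f, g}) →
      ∃ Q : Ideal (MvPolynomial σ K), Q.IsPrime ∧ Ideal.span {f, g} ≤ Q ∧ s ∈ Q ∧ Q.height ≤ 2 := by
  sorry

/-- **Stub 3 — the minor `P₁ = per(x(0|1))` is a non-zero-divisor modulo `I = (per_n, P₀)`**, from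
H(n) (stub 1) and unmixedness (stub 2).  Plan: `ht I ≥ 2` (`P₀` is prime — a renamed
`perPoly_irreducible` — and `per_n ∉ (P₀)`); if `P₁ a ∈ I`, `a ∉ I`, stub 2 gives a prime `Q ⊇ I`,
`P₁ ∈ Q`, `ht Q ≤ 2`; at the generic point of `Q` either all `P_j` vanish (then `ht Q ≥ 3` by stub 1)
or some `P_j ≠ 0`, `j ≥ 2`, and freeing `x_{0j}` (witness `per_n - x₀₀P₀ - x₀₁P₁ = Σ_{j≥2} x_{0j}P_j ∈ Q`,
`X_mul_C_add_C_ne_zero`, `height_ker_aeval_piecewise_insert`) above the chain `⊥ < (P₀) < Q_{x_{0j}}`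
gives `ht Q ≥ 3` — contradiction.  (False at `n = 2`: `x₁₀ · x₀₁ ∈ (per₂, x₁₁)`,
`Disproof.cofactor_not_prime_two`.) -/
theorem stub_rowPartialRegular :
    (∀ n : ℕ, (h : 3 ≤ n) → ∀ P : Ideal (MvPolynomial (Fin n × Fin n) ℂ), P.IsPrime →
      (∀ j : Fin n, pderiv ((⟨0, by omega⟩ : Fin n), j) (perPoly (Fin n) ℂ) ∈ P) →
      (3 : ℕ∞) ≤ P.height) →
    (∀ (K : Type) [Field K] (σ : Type) [Fintype σ] (f g s : MvPolynomial σ K),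
      (2 : ℕ∞) ≤ (Ideal.span {f, g}).height →
      (∃ a : MvPolynomial σ K, a ∉ Ideal.span {f, g} ∧ s * a ∈ Ideal.span {f, g}) →
      ∃ Q : Ideal (MvPolynomial σ K), Q.IsPrime ∧ Ideal.span {f, g} ≤ Q ∧ s ∈ Q ∧ Q.height ≤ 2) →
    ∀ n : ℕ, (h : 3 ≤ n) → ∀ a : MvPolynomial (Fin n × Fin n) ℂ,
      pderiv ((⟨0, by omega⟩ : Fin n), (⟨1, by omega⟩ : Fin n)) (perPoly (Fin n) ℂ) * a ∈
          Ideal.span {perPoly (Fin n) ℂ,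
            pderiv ((⟨0, by omega⟩ : Fin n), (⟨0, by omega⟩ : Fin n)) (perPoly (Fin n) ℂ)} →
        a ∈ Ideal.span {perPoly (Fin n) ℂ,
          pderiv ((⟨0, by omega⟩ : Fin n), (⟨0, by omega⟩ : Fin n)) (perPoly (Fin n) ℂ)} := by
  sorry

/-- **Stub 4 — the cofactor chart is a domain.**  For `n ≥ 3`, `(ℂ[x]/(per_n, P₀))[1/P̄₁]` is an
integral domain: inverting `P₁` and solving the row-`0` Laplace expansion
`per_n = x₀₀P₀ + x₀₁P₁ + Σ_{j≥2} x_{0j}P_j` for `x₀₁` identifies it with `(ℂ[x ∖ x₀₁]/(P₀))[1/P₁]`,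
a nonzero localisation of a domain (`P₀` = permanent of the generic `(n-1) × (n-1)` matrix on rows and
columns `≥ 1`, irreducible by `perPoly_irreducible` after `MvPolynomial.rename`; `P₁ ∉ (P₀)`).
Shares its graph-chart lemma `A[X]/(X·g + h)[1/g] ≃ A[1/g]` with stub 5. -/
theorem stub_cofactorChartIsDomain :
    ∀ n : ℕ, (h : 3 ≤ n) →
      IsDomain (Localization.Away (Ideal.Quotient.mk
        (Ideal.span {perPoly (Fin n) ℂ,
          pderiv ((⟨0, by omega⟩ : Fin n), (⟨0, by omega⟩ : Fin n)) (perPoly (Fin n) ℂ)})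
        (pderiv ((⟨0, by omega⟩ : Fin n), (⟨1, by omega⟩ : Fin n)) (perPoly (Fin n) ℂ)))) := by
  sorry

/-- **Stub 5 — the minor chart of `S_n` is factorial** (`AwayMinorUFD` of the idea card; the
`CofactorChartUFD` shared with line `nagata-laplace-ladder`).  For `n ≥ 3`,
`S_n[1/P̄₀] = ℂ[x][1/P₀]/(per_n)` is a UFD: `per_n = x₀₀·P₀ + (x₀₀-free)`, so inverting `P₀` and
solving for `x₀₀` gives `ℂ[x ∖ x₀₀][1/P₀]`, a localisation of a polynomial ring
(`UniqueFactorizationMonoid.of_isLocalization` / the `MvPolynomial` UFD instance). -/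
theorem stub_awayMinorUFD :
    ∀ n : ℕ, (h : 3 ≤ n) →
      UniqueFactorizationMonoid (Localization.Away (Ideal.Quotient.mk
        (Ideal.span {perPoly (Fin n) ℂ})
        (pderiv ((⟨0, by omega⟩ : Fin n), (⟨0, by omega⟩ : Fin n)) (perPoly (Fin n) ℂ)))) := by
  sorry

/-! ## Glue (sorry-free) -/

/-- `S_n = ℂ[x]/(per_n)` is an integral domain (`perPoly_irreducible` + Gauss). [folklore] -/
theorem isDomain_perRing {n : ℕ} (hn : 3 ≤ n) :
    IsDomain (MvPolynomial (Fin n × Fin n) ℂ ⧸ Ideal.span {perPoly (Fin n) ℂ}) := by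
  haveI : Nonempty (Fin n) := ⟨⟨0, by omega⟩⟩
  have hirr : Irreducible (perPoly (Fin n) ℂ) := perPoly_irreducible
  have hprime : Prime (perPoly (Fin n) ℂ) := hirr.prime
  haveI : (Ideal.span {perPoly (Fin n) ℂ}).IsPrime :=
    (Ideal.span_singleton_prime hprime.ne_zero).mpr hprime
  exact Ideal.Quotient.isDomain _

/-- A ring with a regular element `s` whose localisation `A[1/s]` is a domain is a domain
(`A ↪ A[1/s]`). [folklore] -/
theorem isDomain_of_regular_of_isDomain_away {A : Type*} [CommRing A] (s : A)
    (hs : ∀ a : A, s * a = 0 → a = 0) (hA : IsDomain (Localization.Away s)) : IsDomain A := by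
  have hmem : s ∈ nonZeroDivisors A :=
    mem_nonZeroDivisors_iff.mpr ⟨hs, fun a ha => hs a ((mul_comm s a).trans ha)⟩
  have hinj : Function.Injective (algebraMap A (Localization.Away s)) :=
    IsLocalization.injective (Localization.Away s) (Submonoid.powers_le.mpr hmem)
  exact Function.Injective.isDomain (algebraMap A (Localization.Away s)) hinj

/-- If `(f, p)` is a prime ideal of `A` and `p̄ ≠ 0` in `A/(f)`, then `p̄` is a prime element of
`A/(f)`. [folklore] -/
theorem prime_mk_of_isPrime_span_pair {A : Type*} [CommRing A] {f p : A}
    (hI : (Ideal.span {f, p}).IsPrime) (hp : Ideal.Quotient.mk (Ideal.span {f}) p ≠ 0) :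
    Prime (Ideal.Quotient.mk (Ideal.span {f}) p) := by
  haveI := hI
  have hker : RingHom.ker (Ideal.Quotient.mk (Ideal.span {f})) ≤ Ideal.span {f, p} := by
    rw [Ideal.mk_ker]
    exact Ideal.span_mono (Set.singleton_subset_iff.mpr (Set.mem_insert f {p}))
  have hf0 : Ideal.Quotient.mk (Ideal.span {f}) f = 0 :=
    Ideal.Quotient.eq_zero_iff_mem.mpr (Ideal.subset_span (Set.mem_singleton f))
  have hmap : Ideal.map (Ideal.Quotient.mk (Ideal.span {f})) (Ideal.span {f, p}) =
      Ideal.span {Ideal.Quotient.mk (Ideal.span {f}) p} := by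
    rw [Ideal.map_span, Set.image_insert_eq, Set.image_singleton, hf0, Ideal.span_insert_zero]
  have hprime : (Ideal.span {Ideal.Quotient.mk (Ideal.span {f}) p}).IsPrime := by
    rw [← hmap]
    exact Ideal.map_isPrime_of_surjective Ideal.Quotient.mk_surjective hker
  exact (Ideal.span_singleton_prime hp).mp hprime

/-- The diagonal minor `per(x(i₀|i₀))` is not a multiple of `per_n`: evaluate at the matrix with `1`
on the diagonal off row/column `i₀` and `0` elsewhere (`per_n ↦ 0`, minor `↦ 1`). [folklore] -/
theorem minor_notMem_span_perPoly {n : ℕ} (i0 : Fin n) :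
    pderiv (i0, i0) (perPoly (Fin n) ℂ) ∉ Ideal.span {perPoly (Fin n) ℂ} := by
  classical
  intro hmem
  obtain ⟨q, hq⟩ := Ideal.mem_span_singleton'.mp hmem
  let v : Fin n × Fin n → ℂ := fun rc => if rc.1 = rc.2 ∧ rc.1 ≠ i0 then 1 else 0
  have hper : aeval v (perPoly (Fin n) ℂ) = 0 := by
    rw [perPoly, ← Matrix.subperm_true, aeval_subperm_X]
    exact Matrix.subperm_eq_zero_of_row _ i0 trivial fun i _ => by simp [v]
  have hmin : aeval v (pderiv (i0, i0) (perPoly (Fin n) ℂ)) = 1 := by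
    rw [pderiv_perPoly, aeval_subperm_X]
    refine subperm_eq_one_of_pattern _ (Equiv.refl _) (fun i => ?_) (fun i j hj => ?_)
    · have hi : (i : Fin n) ≠ i0 := i.2
      simp [v, hi]
    · rw [Equiv.refl_apply] at hj
      have hne : (j : Fin n) ≠ (i : Fin n) := fun h' => hj (Subtype.ext h')
      simp [v, hne]
  have h := congrArg (aeval v) hq
  rw [map_mul, hper, mul_zero, hmin] at h
  exact zero_ne_one h

/-- **The composition, with the five stub statements as hypotheses** (sorry-free): stubs 1–5 imply
the crux statement. -/
theorem PermHypersurfaceFactorial_of_stubs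
    (h1 : ∀ n : ℕ, (h : 3 ≤ n) → ∀ P : Ideal (MvPolynomial (Fin n × Fin n) ℂ), P.IsPrime →
      (∀ j : Fin n, pderiv ((⟨0, by omega⟩ : Fin n), j) (perPoly (Fin n) ℂ) ∈ P) →
      (3 : ℕ∞) ≤ P.height)
    (h2 : ∀ (K : Type) [Field K] (σ : Type) [Fintype σ] (f g s : MvPolynomial σ K),
      (2 : ℕ∞) ≤ (Ideal.span {f, g}).height →
      (∃ a : MvPolynomial σ K, a ∉ Ideal.span {f, g} ∧ s * a ∈ Ideal.span {f, g}) →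
      ∃ Q : Ideal (MvPolynomial σ K), Q.IsPrime ∧ Ideal.span {f, g} ≤ Q ∧ s ∈ Q ∧ Q.height ≤ 2)
    (h3 : (∀ n : ℕ, (h : 3 ≤ n) → ∀ P : Ideal (MvPolynomial (Fin n × Fin n) ℂ), P.IsPrime →
        (∀ j : Fin n, pderiv ((⟨0, by omega⟩ : Fin n), j) (perPoly (Fin n) ℂ) ∈ P) →
        (3 : ℕ∞) ≤ P.height) →
      (∀ (K : Type) [Field K] (σ : Type) [Fintype σ] (f g s : MvPolynomial σ K),
        (2 : ℕ∞) ≤ (Ideal.span {f, g}).height →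
        (∃ a : MvPolynomial σ K, a ∉ Ideal.span {f, g} ∧ s * a ∈ Ideal.span {f, g}) →
        ∃ Q : Ideal (MvPolynomial σ K), Q.IsPrime ∧ Ideal.span {f, g} ≤ Q ∧ s ∈ Q ∧ Q.height ≤ 2) →
      ∀ n : ℕ, (h : 3 ≤ n) → ∀ a : MvPolynomial (Fin n × Fin n) ℂ,
        pderiv ((⟨0, by omega⟩ : Fin n), (⟨1, by omega⟩ : Fin n)) (perPoly (Fin n) ℂ) * a ∈
            Ideal.span {perPoly (Fin n) ℂ,
              pderiv ((⟨0, by omega⟩ : Fin n), (⟨0, by omega⟩ : Fin n)) (perPoly (Fin n) ℂ)} →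
          a ∈ Ideal.span {perPoly (Fin n) ℂ,
            pderiv ((⟨0, by omega⟩ : Fin n), (⟨0, by omega⟩ : Fin n)) (perPoly (Fin n) ℂ)})
    (h4 : ∀ n : ℕ, (h : 3 ≤ n) →
      IsDomain (Localization.Away (Ideal.Quotient.mk
        (Ideal.span {perPoly (Fin n) ℂ,
          pderiv ((⟨0, by omega⟩ : Fin n), (⟨0, by omega⟩ : Fin n)) (perPoly (Fin n) ℂ)})
        (pderiv ((⟨0, by omega⟩ : Fin n), (⟨1, by omega⟩ : Fin n)) (perPoly (Fin n) ℂ)))))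
    (h5 : ∀ n : ℕ, (h : 3 ≤ n) →
      UniqueFactorizationMonoid (Localization.Away (Ideal.Quotient.mk
        (Ideal.span {perPoly (Fin n) ℂ})
        (pderiv ((⟨0, by omega⟩ : Fin n), (⟨0, by omega⟩ : Fin n)) (perPoly (Fin n) ℂ))))) :
    ∀ n : ℕ, 3 ≤ n →
      ∀ P : Ideal (MvPolynomial (Fin n × Fin n) ℂ ⧸ Ideal.span {perPoly (Fin n) ℂ}),
        P.IsPrime → P.height = 1 → P.IsPrincipal := by
  intro n hn P hP hP1
  -- the objects of the line at this `n`
  let i0 : Fin n := ⟨0, by omega⟩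
  let i1 : Fin n := ⟨1, by omega⟩
  let P0 : MvPolynomial (Fin n × Fin n) ℂ := pderiv (i0, i0) (perPoly (Fin n) ℂ)
  let P1 : MvPolynomial (Fin n × Fin n) ℂ := pderiv (i0, i1) (perPoly (Fin n) ℂ)
  let I : Ideal (MvPolynomial (Fin n × Fin n) ℂ) := Ideal.span {perPoly (Fin n) ℂ, P0}
  -- stub 3 (fed by stubs 1, 2): `P₁` is regular modulo `I`; stub 4: the chart is a domain
  have hreg : ∀ a, P1 * a ∈ I → a ∈ I := h3 h1 h2 n hn
  have hchart : IsDomain (Localization.Away (Ideal.Quotient.mk I P1)) := h4 n hn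
  -- hence `R/I` is a domain and `I = (per_n, P₀)` is prime
  have hdom : IsDomain (MvPolynomial (Fin n × Fin n) ℂ ⧸ I) := by
    refine isDomain_of_regular_of_isDomain_away (Ideal.Quotient.mk I P1) (fun x hx => ?_) hchart
    obtain ⟨a, rfl⟩ := Ideal.Quotient.mk_surjective x
    rw [← map_mul, Ideal.Quotient.eq_zero_iff_mem] at hx
    exact Ideal.Quotient.eq_zero_iff_mem.mpr (hreg a hx)
  have hIprime : I.IsPrime := (Ideal.Quotient.isDomain_iff_prime I).mp hdom
  -- hence `P̄₀` is a prime element of the noetherian domain `S_n`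
  have hne : Ideal.Quotient.mk (Ideal.span {perPoly (Fin n) ℂ}) P0 ≠ 0 := fun h0 =>
    minor_notMem_span_perPoly i0 (Ideal.Quotient.eq_zero_iff_mem.mp h0)
  have hA : Prime (Ideal.Quotient.mk (Ideal.span {perPoly (Fin n) ℂ}) P0) :=
    prime_mk_of_isPrime_span_pair hIprime hne
  -- Nagata with the UFD chart (stub 5), then height one ⇒ principal
  haveI : IsDomain (MvPolynomial (Fin n × Fin n) ℂ ⧸ Ideal.span {perPoly (Fin n) ℂ}) :=
    isDomain_perRing hn
  haveI : IsNoetherianRing (MvPolynomial (Fin n × Fin n) ℂ ⧸ Ideal.span {perPoly (Fin n) ℂ}) :=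
    inferInstance
  haveI := hP
  have hufd : UniqueFactorizationMonoid
      (MvPolynomial (Fin n × Fin n) ℂ ⧸ Ideal.span {perPoly (Fin n) ℂ}) :=
    (UniqueFactorizationMonoid.iff_localizationAway_of_prime hA).mpr (h5 n hn)
  exact UniqueFactorizationMonoid.isPrincipal_of_height_eq_one hP1

/-- **The skeleton theorem**: the five registered stubs imply the crux, concluded BY NAME. -/
theorem PermHypersurfaceFactorial_of :
    Summit.ValiantsHypothesis.ValiantsHypothesis.Theses.UlrichPadded.PermHypersurfaceFactorial :=
  PermHypersurfaceFactorial_of_stubs stub_rowPartialsHeightThree stub_unmixedHeightTwo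
    stub_rowPartialRegular stub_cofactorChartIsDomain stub_awayMinorUFD

end Summit.ValiantsHypothesis.ValiantsHypothesis.Cruxes.PermHypersurfaceFactorial.SubpermanentHeightThreeNagata
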